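import Literature.MathematicalPhysics.QuantumFieldTheory.Balaban1983to89.B2StepK
import Literature.MathematicalPhysics.QuantumFieldTheory.Balaban1983to89.B2Sect2Statements

/-!
# `Balaban1983to89.B2Lemma25Proof` — [Balaban1982Higgs2] **Lemma 2.5** (2.81) p. 574 and its printed proof
# (2.82)–(2.85) pp. 574–575: the decomposition (2.82) as an exact kernel identity, its three `O(p(L^kε))` estimates
# «where Proposition I.2.3 and the restrictions on the field B were used» KERNEL-CHECKED over matrix coordinates, and
# the row's decl of record `B2Sect2Statements.Lemma25Printed` (+ the twin `B2StepK.Lemma25Printed`) PROVED for that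
# model family

statement-level skeleton of published theorems with citation tags; proofs where landed; nothing here is a claim about the Yang–Mills mass gap

CITATION HEADER.  T. Bałaban, *(Higgs)₂,₃ quantum fields in a finite volume. II. An upper bound*, Commun. Math. Phys.
**86** (1982) 555–594, doi:10.1007/bf01214890 [Balaban1982Higgs2] (cell paper B2; PDF held
`paper:balaban1982-cmp86-higgs23-ii`, journal page = PDF page + 554; pp. 558–560, 574–575 READ AS IMAGES on the ×2 renders
`run/shared/lean/pub/pub-balaban/b2b-balaban-ref1/pages/1982-cmp86-higgs23-II/1982-cmp86-higgs23-II-p004/p005/p006/p020/p021-x2.png`).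
Cell `lit-balaban` (HOME `run/shared/lean/pub/lit-balaban/`), Phase-2 proof seat **p23** gen 4, unit `lit-balaban-p23-g4`;
SKELETON row **B2.Lem2.5** (decl of record `…B2Sect2Statements.Lemma25Printed`, r02 p239259; twin `…B2StepK.Lemma25Printed`,
r14 p239461; both UNCHANGED here), kind «model instance» (PHASE2-TARGETS §G.1); fold owner r02, referee ref-4.  The
constant-field computation (2.83)–(2.85) of the same proof is r14's `…B2StepK.display284` / `display285` /
`display285_bound` (REUSED, not restated); the assembly (2.86) is r14's `…B2StepK.display286` (REUSED).

WHAT IS PRINTED (verbatim, p. 574 [PDF 20] – p. 575 [PDF 21]).  *"The next operation is a translation in the vector fields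
and an expansion of the action with respect to a proper small field. We make the translation A = A′ + aL⁻²C^{(k)}_{Λ₀^{(k)}}Q*B.
(2.80) We would like to show that the field A′ is small on Λ₁^{(k)}. The restrictions on the fields A, φ introduced by the
characteristic functions χ_{Λ₋₁^{(k)}} imply the corresponding restrictions (2.16), (2.17), with ε replaced by L^kε, on the
fields B, ψ. For the second term on the right side of (2.80) we have  **Lemma 2.5.**
aL⁻²(C^{(k)}_{Λ₀^{(k)}}Q*B)(x) = B(y) + O(p(L^kε)) = (Q*B)(x) + O(p(L^kε)),  x ∈ B(y),  y ∈ Λ₁^{(k)′}. (2.81)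
To prove it let us notice that
aL⁻²(C^{(k)}_{Λ₀^{(k)}}Q*B)(x) = aL⁻²(C^{(k)}Q*1)(x)B(y) − aL⁻²(C^{(k)}Q*Λ₀^{(k)′c})(x)B(y) + aL⁻²(C^{(k)}Q*Λ₀^{(k)′}(B − B(y)))(x)
+ aL⁻²(δC^{(k)}_{Λ₀^{(k)}}Q*B)(x) = aL⁻²(C^{(k)}Q*1)(x)B(y) + O(p(L^kε)), (2.82)
where Proposition I.2.3 and the restrictions on the field B were used. We have to calculate aL⁻²C^{(k)}Q*1 = aL⁻²C^{(k)}1,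
where the two units are in different scales. We proceed the same way as in (2.62): aL⁻²C^{(k)}1 = C^{(k)}aL⁻²P1 =
C^{(k)}(Δ^{(k)} + aL⁻²P)1 − C^{(k)}Δ^{(k)}1 = 1 − C^{(k)}Δ^{(k)}1. (2.83) […] (2.84) and hence aL⁻²C^{(k)}1 =
(1 + a⁻¹L²a_kμ₀²(L^kε)²/(a_k + μ₀²(L^kε)²))⁻¹ = 1 + O(μ₀²(L^kε)²). (2.85) This together with (2.82) proves (2.81). From the
above lemma and the restrictions on the fields B, A it follows that the field A′ is small on Λ₁^{(k)}: |A′(x)| = |A(x) −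
aL⁻²(C^{(k)}_{Λ₀^{(k)}}Q*B)(x)| ≤ |A(x) − (Q*B)(x)| + O(1)p(L^kε) ≤ O(1)p(L^kε). (2.86)"*  The inputs the proof names:
Proposition I.2.3 = [Balaban1982Higgs1] Prop. 2.3 pp. 611–612 (typed `…B4.Prop23Printed` / `…B1.Prop23Literal`):
*"|C^{(k)}_Λ(Ω,A;x,x′)| ≦ c₀exp(−δ₀|x−x′|) (1.16) … |δC^{(k)}_Λ(Ω,A;x,x′)| ≦ c₀exp(−δ₀(|x−x′| + dist(x,Λᶜ) + dist(x′,Λᶜ))),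
x, x′ ∈ Λ (1.18)"*; the restrictions (2.17) p. 560 *"|B(y) − A(x)| ≦ 2Ldp(ε) for x ∈ B(y), |B(y)| ≦ (2/(μ₀ε))p(ε) for
y ∈ Λ′₋₁, |B(y) − B(y′)| ≦ 3Ldp(ε) for ⟨y,y′⟩ ∈ Λ′*₋₁. The same estimates … will hold for the fields in each step with ε
replaced by the corresponding L^kε"*; the geometry (2.7)–(2.8) p. 558 *"Λ_{i+1}ᶜ is the sum of all large blocks of T₁
with distances from the set Λ_iᶜ less or equal r(ε)"* (so every point of B(Λ₁′) is farther than r(L^kε) from Λ₀ᶜ) with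
r(ε) = R(1 + log ε⁻¹)^r, r > 1.

THE MODEL (matrix coordinates, the dictionary of r02's `…B2Eq218Translation` for the k = 0 translation (2.18), weight-1
reading of Q*: `(Q*B)(x) = B(y)` for `x ∈ B(y)`, which is the reading in which (2.81) says `= B(y) + O(p) = (Q*B)(x) + O(p)`).
ONE INSTANCE (`KernelModel P X Y`) = one step k: the carrier types `X` ↤ the points of the unit lattice T₁^{(k)} carrying the translation, `T :
Finset X` ↤ all of them (the domain of C^{(k)}), `Λ₀ ⊆ T` ↤ B(Λ₀^{(k)′}) (a union of blocks), `deep ⊆ Λ₀` ↤ B(Λ₁^{(k)′}),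
`blk : X → Y` ↤ x ↦ y with x ∈ B(y); `c` ↤ aL⁻²; `C x x′` ↤ C^{(k)}(x,x′) on T × T and `CΛ x x′` ↤ C^{(k)}_{Λ₀}(x,x′) on
Λ₀ × Λ₀ (Dirichlet conditions outside Λ₀: the B-sum of `C^{(k)}_{Λ₀}Q*B` runs over Λ₀), so `δC^{(k)}_{Λ₀} = CΛ − C` on
Λ₀ × Λ₀ exactly as in (I.2.35); `d x x′` ↤ |x − x′|, `u x` ↤ dist(x, Λ₀ᶜ) (`u_le_d`: a point outside Λ₀ is at least that far);
`R` ↤ the separation of (2.7)–(2.8) (`R_le_u` on `deep`); `κ` ↤ the number aL⁻²C^{(k)}1 of (2.83)–(2.85) (`sumC`; its value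
and the bound |κ − 1| ≤ (L²/a)μ₀²(L^kε)² are r14's `display285`/`display285_bound`, imported by `kappa_of_display285`); `p` ↤
p(L^kε); `tB` ↤ the threshold 2/(μ₀L^kε) of (2.17)₂.  The FIXED constants of the family (`Consts`): `c₀`, `δ` ↤ c₀, δ₀ of
Prop. I.2.3; `S` ↤ a bound for the lattice sums Σ_{x′}exp(−½δ₀|x − x′|) (on ℤ^ν: (1 + 4/δ₀)^ν, PROVED in §5
`sum_exp_neg_l1dist_le`, the pattern of `…B10Eq45LatticeSum.sum_exp_neg_l1dist_le`); `r₁`, `r₂` ↤ the integrated form of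
(2.17)₃ (|B(y′) − B(y)| ≤ 3Ldp·|y − y′|₁ along lattice paths inside Λ₀′, |y − y′|₁ ≤ |x − x′|₁/L + ν: r₁ = 3Ldν, r₂ = 3d);
`K₁` ↤ a bound for |κ − 1|·tB (= 2L²μ₀L^kε/a ≤ 2L²/a, `kappa_of_display285`); `K₂` ↤ a bound for exp(−½δ₀R)·tB (the
separation r(L^kε) beats (μ₀L^kε)⁻¹: from r14's `RDecayBeatsPowers` with κ = 1, `sep_of_rDecayBeatsPowers`).  The Prop. I.2.3
shapes (1.16), (1.18) are FIELDS of the instance (hypotheses, as in `…B4.Prop23Printed`, which is a `Prop` over abstract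
carriers); the restrictions (2.17) at scale L^kε form the predicate `KernelModel.Restr` = the `restrB` of the row's carrier.

WHAT IS PROVED.  §0 the decay-kernel engine ([folklore] real analysis: far-supported / Lipschitz-controlled / doubly-damped
sums against c₀e^{−δ|x−x′|}); §1 **(2.82)** as an exact identity (`eq282`); §2 the three estimates and **(2.81) pointwise**
(`lemma25_pointwise`: |aL⁻²(C^{(k)}_{Λ₀}Q*B)(x) − B(y)| ≤ 𝒞·p(L^kε) on B(Λ₁′) with the explicit 𝒞 = K₁ + c·c₀·S·(4K₂ + r₁ +
2r₂/δ₀) of `Consts.O1`); §3 **row B2.Lem2.5**: `lemma25Printed_model : B2Sect2Statements.Lemma25Printed (famOf P)` and the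
twin `lemma25Printed_model_StepK : B2StepK.Lemma25Printed (famOfStepK P)` for the family of ALL instances with constants `P`;
(2.86) for the model (`ineq286_model`, via r14's `display286`); §4 the discharges `kappa_of_display285` ((2.85) ⇒ the `K₁`
field) and `sep_of_rDecayBeatsPowers` ((2.7)–(2.8) + (2.109)-type decay ⇒ the `K₂` field); §5 the ℤ^ν summability constant.
NOT CLAIMED: Proposition I.2.3 itself (an input, as in print), the identification of the abstract kernels with Bałaban's
covariances, anything about the functional integral (2.53).  No `sorry`, no new `def … : Prop` leaf; axioms standard.
-/

namespace Literature.MathematicalPhysics.QuantumFieldTheory.Balaban1983to89.B2Lemma25Proof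

open Finset Real
open Literature.MathematicalPhysics.QuantumFieldTheory.Balaban1983to89

/-! ## §0. The decay-kernel engine (elementary real analysis) -/

section Engine

variable {X : Type*}

/-- `t·e^{−bt} ≤ 1/b` for `b > 0` (from `bt + 1 ≤ e^{bt}`). [folklore] -/
private theorem mul_exp_neg_le {b : ℝ} (hb : 0 < b) (t : ℝ) : t * Real.exp (-(b * t)) ≤ 1 / b := by
  have h1 : b * t + 1 ≤ Real.exp (b * t) := Real.add_one_le_exp (b * t)
  have h2 : b * t * Real.exp (-(b * t)) ≤ 1 := by
    calc b * t * Real.exp (-(b * t)) ≤ Real.exp (b * t) * Real.exp (-(b * t)) :=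
          mul_le_mul_of_nonneg_right (by linarith) (Real.exp_pos _).le
      _ = 1 := by rw [← Real.exp_add, add_neg_cancel, Real.exp_zero]
  rw [le_div_iff₀ hb]
  linarith [h2]

/-- Half of the decay pays for a linear factor: `e^{−at}·t ≤ (2/a)e^{−at/2}` (`a > 0`). [folklore] -/
private theorem exp_neg_mul_self_le {a : ℝ} (ha : 0 < a) (t : ℝ) :
    Real.exp (-(a * t)) * t ≤ (2 / a) * Real.exp (-(a / 2 * t)) := by
  have hsplit : Real.exp (-(a * t)) = Real.exp (-(a / 2 * t)) * Real.exp (-(a / 2 * t)) := by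
    rw [← Real.exp_add]; congr 1; ring
  have h := mul_exp_neg_le (half_pos ha) t
  have h' : 1 / (a / 2) = 2 / a := one_div_div a 2
  calc Real.exp (-(a * t)) * t
      = (t * Real.exp (-(a / 2 * t))) * Real.exp (-(a / 2 * t)) := by rw [hsplit]; ring
    _ ≤ (1 / (a / 2)) * Real.exp (-(a / 2 * t)) := mul_le_mul_of_nonneg_right h (Real.exp_pos _).le
    _ = (2 / a) * Real.exp (-(a / 2 * t)) := by rw [h']

/-- Half of the decay is kept: `e^{−at} ≤ e^{−(a/2)t}` for `a, t ≥ 0`. [folklore] -/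
private theorem exp_neg_le_exp_neg_half {a t : ℝ} (ha : 0 ≤ a) (ht : 0 ≤ t) :
    Real.exp (-(a * t)) ≤ Real.exp (-(a / 2 * t)) := by
  rw [Real.exp_le_exp]; nlinarith

/-- Beyond the radius `R` the other half of the decay is a uniform small factor: `e^{−at} ≤ e^{−(a/2)R}·e^{−(a/2)t}` for
`a ≥ 0`, `R ≤ t`. [folklore] -/
private theorem exp_neg_le_far {a t R : ℝ} (ha : 0 ≤ a) (hRt : R ≤ t) :
    Real.exp (-(a * t)) ≤ Real.exp (-(a / 2 * R)) * Real.exp (-(a / 2 * t)) := by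
  rw [← Real.exp_add, Real.exp_le_exp]; nlinarith

/-- The triangle inequality for a kernel sum: `|Σ_{x′} K(x′)g(x′)| ≤ Σ_{x′} |K(x′)|·|g(x′)|`. [folklore] -/
private theorem abs_sum_mul_le (S : Finset X) (K g : X → ℝ) :
    |∑ x' ∈ S, K x' * g x'| ≤ ∑ x' ∈ S, |K x'| * |g x'| := by
  refine (Finset.abs_sum_le_sum_abs _ _).trans (le_of_eq ?_)
  exact Finset.sum_congr rfl fun x _ => abs_mul _ _

/-- ENGINE 1 (a far-supported bounded function against a decaying kernel): if `|K(x′)| ≤ c₀e^{−δd(x′)}`, `g` vanishes where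
`d < R` and `|g| ≤ G`, then `|Σ K g| ≤ c₀·e^{−(δ/2)R}·G·Σe^{−(δ/2)d}` — the estimate behind the second term of (2.82)
(the blocks of Λ₀′ᶜ) and the far part of its third term. [cite: Balaban1982Higgs2, (2.82) p.574] -/
theorem far_sum_bound {S : Finset X} {K g d : X → ℝ} {c₀ δ R G Ssum : ℝ} (hc₀ : 0 ≤ c₀) (hδ : 0 ≤ δ) (hG : 0 ≤ G)
    (hK : ∀ x' ∈ S, |K x'| ≤ c₀ * Real.exp (-(δ * d x')))
    (hfar : ∀ x' ∈ S, g x' ≠ 0 → R ≤ d x') (hg : ∀ x' ∈ S, |g x'| ≤ G)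
    (hS : ∑ x' ∈ S, Real.exp (-(δ / 2 * d x')) ≤ Ssum) :
    |∑ x' ∈ S, K x' * g x'| ≤ c₀ * Real.exp (-(δ / 2 * R)) * G * Ssum := by
  have hterm : ∀ x' ∈ S, |K x'| * |g x'| ≤ c₀ * Real.exp (-(δ / 2 * R)) * G * Real.exp (-(δ / 2 * d x')) := by
    intro x' hx'
    by_cases hg0 : g x' = 0
    · rw [hg0, abs_zero, mul_zero]; positivity
    · have h1 := exp_neg_le_far (t := d x') hδ (hfar x' hx' hg0)
      calc |K x'| * |g x'| ≤ (c₀ * Real.exp (-(δ * d x'))) * G :=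
            mul_le_mul (hK x' hx') (hg x' hx') (abs_nonneg _) (by positivity)
        _ ≤ (c₀ * (Real.exp (-(δ / 2 * R)) * Real.exp (-(δ / 2 * d x')))) * G :=
            mul_le_mul_of_nonneg_right (mul_le_mul_of_nonneg_left h1 hc₀) hG
        _ = c₀ * Real.exp (-(δ / 2 * R)) * G * Real.exp (-(δ / 2 * d x')) := by ring
  calc |∑ x' ∈ S, K x' * g x'| ≤ ∑ x' ∈ S, |K x'| * |g x'| := abs_sum_mul_le S K g
    _ ≤ ∑ x' ∈ S, c₀ * Real.exp (-(δ / 2 * R)) * G * Real.exp (-(δ / 2 * d x')) := Finset.sum_le_sum hterm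
    _ = c₀ * Real.exp (-(δ / 2 * R)) * G * ∑ x' ∈ S, Real.exp (-(δ / 2 * d x')) := by rw [Finset.mul_sum]
    _ ≤ c₀ * Real.exp (-(δ / 2 * R)) * G * Ssum := mul_le_mul_of_nonneg_left hS (by positivity)

/-- ENGINE 2 (a Lipschitz-controlled function against a decaying kernel): if `|K(x′)| ≤ c₀e^{−δd(x′)}` and `|g(x′)| ≤
p(r₁ + r₂d(x′))` with `d ≥ 0`, then `|Σ K g| ≤ c₀·p·(r₁ + 2r₂/δ)·Σe^{−(δ/2)d}` — the estimate behind the third term of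
(2.82) («the restrictions on the field B»). [cite: Balaban1982Higgs2, (2.82) p.574] -/
theorem lipschitz_sum_bound {S : Finset X} {K g d : X → ℝ} {c₀ δ p r₁ r₂ Ssum : ℝ} (hc₀ : 0 ≤ c₀) (hδ : 0 < δ)
    (hp : 0 ≤ p) (hr₁ : 0 ≤ r₁) (hr₂ : 0 ≤ r₂) (hd : ∀ x' ∈ S, 0 ≤ d x')
    (hK : ∀ x' ∈ S, |K x'| ≤ c₀ * Real.exp (-(δ * d x')))
    (hg : ∀ x' ∈ S, |g x'| ≤ p * (r₁ + r₂ * d x'))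
    (hS : ∑ x' ∈ S, Real.exp (-(δ / 2 * d x')) ≤ Ssum) :
    |∑ x' ∈ S, K x' * g x'| ≤ c₀ * p * (r₁ + r₂ * (2 / δ)) * Ssum := by
  have hterm : ∀ x' ∈ S, |K x'| * |g x'| ≤ c₀ * p * (r₁ + r₂ * (2 / δ)) * Real.exp (-(δ / 2 * d x')) := by
    intro x' hx'
    have h1 : Real.exp (-(δ * d x')) ≤ Real.exp (-(δ / 2 * d x')) := exp_neg_le_exp_neg_half hδ.le (hd x' hx')
    have h2 : Real.exp (-(δ * d x')) * d x' ≤ (2 / δ) * Real.exp (-(δ / 2 * d x')) := exp_neg_mul_self_le hδ (d x')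
    calc |K x'| * |g x'| ≤ (c₀ * Real.exp (-(δ * d x'))) * (p * (r₁ + r₂ * d x')) :=
          mul_le_mul (hK x' hx') (hg x' hx') (abs_nonneg _) (by positivity)
      _ = c₀ * p * (r₁ * Real.exp (-(δ * d x')) + r₂ * (Real.exp (-(δ * d x')) * d x')) := by ring
      _ ≤ c₀ * p * (r₁ * Real.exp (-(δ / 2 * d x')) + r₂ * ((2 / δ) * Real.exp (-(δ / 2 * d x')))) := by
          apply mul_le_mul_of_nonneg_left _ (by positivity)
          exact add_le_add (mul_le_mul_of_nonneg_left h1 hr₁) (mul_le_mul_of_nonneg_left h2 hr₂)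
      _ = c₀ * p * (r₁ + r₂ * (2 / δ)) * Real.exp (-(δ / 2 * d x')) := by ring
  calc |∑ x' ∈ S, K x' * g x'| ≤ ∑ x' ∈ S, |K x'| * |g x'| := abs_sum_mul_le S K g
    _ ≤ ∑ x' ∈ S, c₀ * p * (r₁ + r₂ * (2 / δ)) * Real.exp (-(δ / 2 * d x')) := Finset.sum_le_sum hterm
    _ = c₀ * p * (r₁ + r₂ * (2 / δ)) * ∑ x' ∈ S, Real.exp (-(δ / 2 * d x')) := by rw [Finset.mul_sum]
    _ ≤ c₀ * p * (r₁ + r₂ * (2 / δ)) * Ssum := mul_le_mul_of_nonneg_left hS (by positivity)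

/-- ENGINE 3 (a doubly-damped kernel, the shape of (I.2.36)/(1.18)): if `|D(x′)| ≤ c₀e^{−δ(d(x′) + u + u′(x′))}` with
`u ≥ R`, `u′ ≥ 0`, `d ≥ 0` and `|g| ≤ G`, then `|Σ D g| ≤ c₀·e^{−δR}·G·Σe^{−(δ/2)d}` — the estimate behind the fourth term of
(2.82) (δC^{(k)}_{Λ₀} with (I.2.36)). [cite: Balaban1982Higgs2, (2.82) p.574] -/
theorem damped_sum_bound {S : Finset X} {D g d u' : X → ℝ} {c₀ δ R G u Ssum : ℝ} (hc₀ : 0 ≤ c₀) (hδ : 0 ≤ δ)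
    (hG : 0 ≤ G) (hRu : R ≤ u) (hu' : ∀ x' ∈ S, 0 ≤ u' x') (hd : ∀ x' ∈ S, 0 ≤ d x')
    (hD : ∀ x' ∈ S, |D x'| ≤ c₀ * Real.exp (-(δ * (d x' + u + u' x'))))
    (hg : ∀ x' ∈ S, |g x'| ≤ G) (hS : ∑ x' ∈ S, Real.exp (-(δ / 2 * d x')) ≤ Ssum) :
    |∑ x' ∈ S, D x' * g x'| ≤ c₀ * Real.exp (-(δ * R)) * G * Ssum := by
  have hterm : ∀ x' ∈ S, |D x'| * |g x'| ≤ c₀ * Real.exp (-(δ * R)) * G * Real.exp (-(δ / 2 * d x')) := by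
    intro x' hx'
    have h1 : Real.exp (-(δ * (d x' + u + u' x'))) ≤ Real.exp (-(δ * R)) * Real.exp (-(δ / 2 * d x')) := by
      rw [← Real.exp_add, Real.exp_le_exp]
      have := hu' x' hx'; have := hd x' hx'
      nlinarith
    calc |D x'| * |g x'| ≤ (c₀ * Real.exp (-(δ * (d x' + u + u' x')))) * G :=
          mul_le_mul (hD x' hx') (hg x' hx') (abs_nonneg _) (by positivity)
      _ ≤ (c₀ * (Real.exp (-(δ * R)) * Real.exp (-(δ / 2 * d x')))) * G :=
          mul_le_mul_of_nonneg_right (mul_le_mul_of_nonneg_left h1 hc₀) hG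
      _ = c₀ * Real.exp (-(δ * R)) * G * Real.exp (-(δ / 2 * d x')) := by ring
  calc |∑ x' ∈ S, D x' * g x'| ≤ ∑ x' ∈ S, |D x'| * |g x'| := abs_sum_mul_le S D g
    _ ≤ ∑ x' ∈ S, c₀ * Real.exp (-(δ * R)) * G * Real.exp (-(δ / 2 * d x')) := Finset.sum_le_sum hterm
    _ = c₀ * Real.exp (-(δ * R)) * G * ∑ x' ∈ S, Real.exp (-(δ / 2 * d x')) := by rw [Finset.mul_sum]
    _ ≤ c₀ * Real.exp (-(δ * R)) * G * Ssum := mul_le_mul_of_nonneg_left hS (by positivity)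

end Engine

/-! ## §1. (2.82): the decomposition as an exact kernel identity -/

section Identity

variable {X Y : Type*}

/-- **(2.82)** p. 574 [PDF 20], the decomposition, as an EXACT identity of finite sums: with `y = blk x`, `C` the kernel of
C^{(k)} on the whole lattice `T`, `CΛ` the kernel of C^{(k)}_{Λ₀} on `Λ₀ ⊆ T` (so that `CΛ − C` on Λ₀ × Λ₀ is δC^{(k)}_{Λ₀} of
(I.2.35)) and `(Q*B)(x′) = B(blk x′)`:
`aL⁻²(C_{Λ₀}Q*B)(x) = aL⁻²(CQ*1)(x)B(y) − aL⁻²(CQ*χ_{Λ₀′ᶜ})(x)B(y) + aL⁻²(CQ*χ_{Λ₀′}(B − B(y)))(x) + aL⁻²(δC_{Λ₀}Q*B)(x)`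
(the B-sum of the left side runs over Λ₀ = B(Λ₀′), the blocks of Λ₀′; `χ_{Λ₀′ᶜ}` selects the points of `T ∖ Λ₀`).
[cite: Balaban1982Higgs2, (2.82) p.574] -/
theorem eq282 [DecidableEq X] (T Λ₀ : Finset X) (hΛ : Λ₀ ⊆ T) (c : ℝ) (C CΛ : X → X → ℝ) (blk : X → Y) (B : Y → ℝ)
    (x : X) :
    c * ∑ x' ∈ Λ₀, CΛ x x' * B (blk x') =
      (c * ∑ x' ∈ T, C x x') * B (blk x) - (c * ∑ x' ∈ T \ Λ₀, C x x') * B (blk x) +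
        c * ∑ x' ∈ Λ₀, C x x' * (B (blk x') - B (blk x)) +
          c * ∑ x' ∈ Λ₀, (CΛ x x' - C x x') * B (blk x') := by
  rw [← Finset.sum_sdiff hΛ]
  have e3 : ∑ x' ∈ Λ₀, C x x' * (B (blk x') - B (blk x)) =
      ∑ x' ∈ Λ₀, C x x' * B (blk x') - (∑ x' ∈ Λ₀, C x x') * B (blk x) := by
    rw [Finset.sum_mul, ← Finset.sum_sub_distrib]
    exact Finset.sum_congr rfl fun _ _ => by ring
  have e4 : ∑ x' ∈ Λ₀, (CΛ x x' - C x x') * B (blk x') =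
      ∑ x' ∈ Λ₀, CΛ x x' * B (blk x') - ∑ x' ∈ Λ₀, C x x' * B (blk x') := by
    rw [← Finset.sum_sub_distrib]
    exact Finset.sum_congr rfl fun _ _ => by ring
  rw [e3, e4]
  ring

end Identity

/-! ## §2. The model of one step and Lemma 2.5 pointwise -/

/-- The FIXED constants of the model family (chosen before the instance, so that the `O(·)` of (2.81) is uniform): `c` ↤ aL⁻²;
`c₀`, `δ` ↤ c₀, δ₀ of Proposition I.2.3 (1.16)/(1.18); `S` ↤ a bound for Σ_{x′}e^{−½δ₀|x−x′|} (volume of the lattice: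
`(1 + 4/δ₀)^ν` on ℤ^ν, §5); `r₁`, `r₂` ↤ the integrated restriction (2.17)₃ (|B(y′) − B(y)| ≤ p(r₁ + r₂|x − x′|) inside
Λ₀′); `K₁` ↤ a bound for |aL⁻²C^{(k)}1 − 1|·(2/(μ₀L^kε)) ((2.85): `≤ 2L²/a`, §4); `K₂` ↤ a bound for
e^{−½δ₀·dist(B(Λ₁′),Λ₀ᶜ)}·(2/(μ₀L^kε)) ((2.7)–(2.8): §4). [cite: Balaban1982Higgs2, Lemma 2.5 (2.81)–(2.85) pp.574–575] -/
structure Consts where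
  c : ℝ
  c₀ : ℝ
  δ : ℝ
  S : ℝ
  r₁ : ℝ
  r₂ : ℝ
  K₁ : ℝ
  K₂ : ℝ

/-- Sign conditions on the constants (`c = aL⁻² ≥ 0`, `c₀ ≥ 0`, `δ₀ > 0`, …). [cite: Balaban1982Higgs2, Lemma 2.5 (2.81) p.574] -/
structure Consts.Valid (P : Consts) : Prop where
  c_nonneg : 0 ≤ P.c
  c₀_nonneg : 0 ≤ P.c₀
  δ_pos : 0 < P.δ
  S_nonneg : 0 ≤ P.S
  r₁_nonneg : 0 ≤ P.r₁
  r₂_nonneg : 0 ≤ P.r₂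
  K₁_nonneg : 0 ≤ P.K₁
  K₂_nonneg : 0 ≤ P.K₂

/-- The `O(1)` of (2.81) for the family with constants `P`: `𝒞 = K₁ + c·c₀·S·(4K₂ + r₁ + 2r₂/δ₀)` (term by term: (κ − 1)B(y);
the blocks outside Λ₀′; the near and far parts of CQ*χ_{Λ₀′}(B − B(y)); δC_{Λ₀}Q*B). [cite: Balaban1982Higgs2, Lemma 2.5 (2.81)–(2.82) p.574] -/
noncomputable def Consts.O1 (P : Consts) : ℝ := P.K₁ + P.c * P.c₀ * P.S * (4 * P.K₂ + P.r₁ + P.r₂ * (2 / P.δ))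

/-- The `O(1)` of (2.81) is non-negative. [cite: Balaban1982Higgs2, Lemma 2.5 (2.81) p.574] -/
theorem Consts.O1_nonneg {P : Consts} (hP : P.Valid) : 0 ≤ P.O1 := by
  have := hP.c_nonneg; have := hP.c₀_nonneg; have := hP.δ_pos; have := hP.S_nonneg; have := hP.r₁_nonneg
  have := hP.r₂_nonneg; have := hP.K₁_nonneg; have := hP.K₂_nonneg
  unfold Consts.O1; positivity

/-- ONE INSTANCE of the setting of Lemma 2.5 (one step k; see the module docstring for the dictionary): the unit-lattice
points `T`, the region `Λ₀ = B(Λ₀^{(k)′}) ⊆ T`, the deep set `deep = B(Λ₁^{(k)′}) ⊆ Λ₀`, the block map, the kernels of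
C^{(k)} and C^{(k)}_{Λ₀^{(k)}} CARRYING the Proposition I.2.3 shapes (1.16), (1.18) as fields (`kerC`, `kerDC`), the number
κ = aL⁻²C^{(k)}1 of (2.83)–(2.85) (`sumC`, `kappa`), the separation (2.7)–(2.8) (`R_le_u`, `sep`), the scale data p(L^kε),
2/(μ₀L^kε), and the block field `B`.  The restrictions (2.17) on `B` are NOT fields: they form the predicate `Restr` (= the
`restrB` hypothesis of the row's carrier). [cite: Balaban1982Higgs2, Lemma 2.5 (2.81)–(2.82) p.574; (2.7)–(2.8) p.558] -/
structure KernelModel (P : Consts) (X Y : Type) [DecidableEq X] where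
  /-- all points (the domain of C^{(k)}) -/
  T : Finset X
  /-- Λ₀ = B(Λ₀^{(k)′}) -/
  Λ₀ : Finset X
  /-- B(Λ₁^{(k)′}), where (2.81) is asserted -/
  deep : Finset X
  /-- x ↦ y with x ∈ B(y) -/
  blk : X → Y
  /-- kernel of C^{(k)} -/
  C : X → X → ℝ
  /-- kernel of C^{(k)}_{Λ₀^{(k)}} on Λ₀ × Λ₀ -/
  CΛ : X → X → ℝ
  /-- |x − x′| -/
  d : X → X → ℝ
  /-- dist(x, Λ₀ᶜ) -/
  u : X → ℝ
  /-- the constant aL⁻²C^{(k)}1 of (2.83)–(2.85) -/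
  κ : ℝ
  /-- the separation radius of (2.7)–(2.8) (> r(L^kε)) -/
  R : ℝ
  /-- p(L^kε) -/
  p : ℝ
  /-- the threshold 2/(μ₀L^kε) of (2.17)₂ -/
  tB : ℝ
  /-- the block field B -/
  B : Y → ℝ
  Λ₀_sub : Λ₀ ⊆ T
  deep_sub : deep ⊆ Λ₀
  d_nonneg : ∀ x x', 0 ≤ d x x'
  u_nonneg : ∀ x, 0 ≤ u x
  u_le_d : ∀ x ∈ Λ₀, ∀ x' ∈ T, x' ∉ Λ₀ → u x ≤ d x x'
  R_nonneg : 0 ≤ R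
  R_le_u : ∀ x ∈ deep, R ≤ u x
  p_nonneg : 0 ≤ p
  tB_nonneg : 0 ≤ tB
  /-- (I.2.36)/(1.16): |C^{(k)}(x,x′)| ≤ c₀e^{−δ₀|x−x′|} -/
  kerC : ∀ x ∈ T, ∀ x' ∈ T, |C x x'| ≤ P.c₀ * Real.exp (-(P.δ * d x x'))
  /-- (I.2.36)/(1.18): |δC^{(k)}_{Λ₀}(x,x′)| ≤ c₀e^{−δ₀(|x−x′| + dist(x,Λ₀ᶜ) + dist(x′,Λ₀ᶜ))}, x, x′ ∈ Λ₀ -/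
  kerDC : ∀ x ∈ Λ₀, ∀ x' ∈ Λ₀, |CΛ x x' - C x x'| ≤ P.c₀ * Real.exp (-(P.δ * (d x x' + u x + u x')))
  /-- (2.83): aL⁻²C^{(k)}1 = κ·1 -/
  sumC : ∀ x ∈ T, P.c * ∑ x' ∈ T, C x x' = κ
  /-- (2.85) against the threshold of (2.17)₂: |κ − 1|·2/(μ₀L^kε) ≤ K₁ -/
  kappa : |κ - 1| * tB ≤ P.K₁
  /-- (2.7)–(2.8): the separation beats (μ₀L^kε)⁻¹: e^{−½δ₀R}·2/(μ₀L^kε) ≤ K₂ -/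
  sep : Real.exp (-(P.δ / 2 * R)) * tB ≤ P.K₂
  /-- the volume constant: Σ_{x′∈T}e^{−½δ₀|x−x′|} ≤ S -/
  summable : ∀ x ∈ T, ∑ x' ∈ T, Real.exp (-(P.δ / 2 * d x x')) ≤ P.S

namespace KernelModel

variable {P : Consts} {X Y : Type} [DecidableEq X] (m : KernelModel P X Y)

/-- «the restrictions on the field B» at scale L^kε ((2.17) p. 560 with ε ↦ L^kε): (2.17)₂ `|B(y′)| ≤ (2/(μ₀L^kε))p(L^kε)`
on Λ₀′, and (2.17)₃ in integrated form along lattice paths staying inside Λ₀′ — for blocks y′ reachable within the distance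
dist(x, Λ₀ᶜ): `|B(y′) − B(y)| ≤ p(L^kε)(r₁ + r₂|x − x′|)`. [cite: Balaban1982Higgs2, (2.17) p.560; Lemma 2.5 p.574] -/
structure Restr : Prop where
  /-- (2.17)₂ at scale L^kε on the blocks of Λ₀′ -/
  bound : ∀ x' ∈ m.Λ₀, |m.B (m.blk x')| ≤ m.tB * m.p
  /-- (2.17)₃ at scale L^kε, integrated along lattice paths inside Λ₀′ -/
  lipschitz : ∀ x ∈ m.deep, ∀ x' ∈ m.Λ₀, m.d x x' ≤ m.u x →
    |m.B (m.blk x') - m.B (m.blk x)| ≤ m.p * (P.r₁ + P.r₂ * m.d x x')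

/-- `aL⁻²(C^{(k)}_{Λ₀^{(k)}}Q*B)(x)`: the left side of (2.81) in the model (the B-sum runs over Λ₀, Dirichlet conditions
outside Λ₀). [cite: Balaban1982Higgs2, (2.80)–(2.81) p.574] -/
def CQsB (x : X) : ℝ := P.c * ∑ x' ∈ m.Λ₀, m.CΛ x x' * m.B (m.blk x')

/-- `(Q*B)(x) = B(y)` for `x ∈ B(y)` (weight-1 reading of the adjoint block averaging, the reading in which (2.81) states
`B(y) + O(p) = (Q*B)(x) + O(p)`). [cite: Balaban1982Higgs2, (2.81) p.574] -/
def QsB (x : X) : ℝ := m.B (m.blk x)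

/-- TERM 1 of (2.82) with (2.85): `|aL⁻²(C^{(k)}Q*1)(x)B(y) − B(y)| = |κ − 1||B(y)| ≤ K₁·p`. [cite: Balaban1982Higgs2, (2.82)+(2.85) pp.574–575] -/
theorem term1_bound (hR : m.Restr) {x : X} (hx : x ∈ m.deep) :
    |(P.c * ∑ x' ∈ m.T, m.C x x') * m.B (m.blk x) - m.B (m.blk x)| ≤ P.K₁ * m.p := by
  rw [m.sumC x (m.Λ₀_sub (m.deep_sub hx))]
  have hB := hR.1 x (m.deep_sub hx)
  calc |m.κ * m.B (m.blk x) - m.B (m.blk x)| = |m.κ - 1| * |m.B (m.blk x)| := by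
        rw [← abs_mul]; congr 1; ring
    _ ≤ |m.κ - 1| * (m.tB * m.p) := mul_le_mul_of_nonneg_left hB (abs_nonneg _)
    _ = (|m.κ - 1| * m.tB) * m.p := by ring
    _ ≤ P.K₁ * m.p := mul_le_mul_of_nonneg_right m.kappa m.p_nonneg

/-- TERM 2 of (2.82): the blocks outside Λ₀′ are farther than dist(x, Λ₀ᶜ) ≥ R from x, so by (1.16)
`|aL⁻²(C^{(k)}Q*χ_{Λ₀′ᶜ})(x)B(y)| ≤ c·c₀e^{−½δ₀R}S·(2/(μ₀L^kε))p ≤ c·c₀·S·K₂·p`. [cite: Balaban1982Higgs2, (2.82) p.574] -/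
theorem term2_bound (hP : P.Valid) (hR : m.Restr) {x : X} (hx : x ∈ m.deep) :
    |(P.c * ∑ x' ∈ m.T \ m.Λ₀, m.C x x') * m.B (m.blk x)| ≤ P.c * P.c₀ * P.S * P.K₂ * m.p := by
  have hxΛ : x ∈ m.Λ₀ := m.deep_sub hx
  have hxT : x ∈ m.T := m.Λ₀_sub hxΛ
  -- the kernel sum over T ∖ Λ₀ against the constant function 1
  have hfar : |∑ x' ∈ m.T \ m.Λ₀, m.C x x' * (1 : ℝ)| ≤
      P.c₀ * Real.exp (-(P.δ / 2 * m.R)) * 1 * P.S := by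
    refine far_sum_bound (d := fun x' => m.d x x') hP.c₀_nonneg hP.δ_pos.le zero_le_one ?_ ?_ ?_ ?_
    · intro x' hx'
      exact m.kerC x hxT x' (Finset.mem_sdiff.mp hx').1
    · intro x' hx' _
      obtain ⟨hT, hnot⟩ := Finset.mem_sdiff.mp hx'
      exact (m.R_le_u x hx).trans (m.u_le_d x hxΛ x' hT hnot)
    · intro x' _; simp
    · calc ∑ x' ∈ m.T \ m.Λ₀, Real.exp (-(P.δ / 2 * m.d x x'))
          ≤ ∑ x' ∈ m.T, Real.exp (-(P.δ / 2 * m.d x x')) :=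
            Finset.sum_le_sum_of_subset_of_nonneg Finset.sdiff_subset fun _ _ _ => (Real.exp_pos _).le
        _ ≤ P.S := m.summable x hxT
  simp only [mul_one] at hfar
  have hB := hR.1 x hxΛ
  have hsep := m.sep
  have hc := hP.c_nonneg
  have hc₀ := hP.c₀_nonneg
  have hS := hP.S_nonneg
  calc |(P.c * ∑ x' ∈ m.T \ m.Λ₀, m.C x x') * m.B (m.blk x)|
      = P.c * |∑ x' ∈ m.T \ m.Λ₀, m.C x x'| * |m.B (m.blk x)| := by
        rw [abs_mul, abs_mul, abs_of_nonneg hc]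
    _ ≤ P.c * (P.c₀ * Real.exp (-(P.δ / 2 * m.R)) * P.S) * (m.tB * m.p) :=
        mul_le_mul (mul_le_mul_of_nonneg_left hfar hc) hB (abs_nonneg _) (by positivity)
    _ = P.c * P.c₀ * P.S * (Real.exp (-(P.δ / 2 * m.R)) * m.tB) * m.p := by ring
    _ ≤ P.c * P.c₀ * P.S * P.K₂ * m.p := by
        apply mul_le_mul_of_nonneg_right _ m.p_nonneg
        exact mul_le_mul_of_nonneg_left hsep (by positivity)

/-- TERM 3 of (2.82): `|aL⁻²(C^{(k)}Q*χ_{Λ₀′}(B − B(y)))(x)| ≤ c·c₀·S·(r₁ + 2r₂/δ₀ + 2K₂)·p` — the blocks within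
dist(x, Λ₀ᶜ) by the restriction (2.17)₃ (ENGINE 2), the farther ones by (2.17)₂ twice and the decay beyond R (ENGINE 1).
[cite: Balaban1982Higgs2, (2.82) p.574; (2.17) p.560] -/
theorem term3_bound (hP : P.Valid) (hR : m.Restr) {x : X} (hx : x ∈ m.deep) :
    |P.c * ∑ x' ∈ m.Λ₀, m.C x x' * (m.B (m.blk x') - m.B (m.blk x))| ≤
      P.c * P.c₀ * P.S * (P.r₁ + P.r₂ * (2 / P.δ) + 2 * P.K₂) * m.p := by
  have hxΛ : x ∈ m.Λ₀ := m.deep_sub hx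
  have hxT : x ∈ m.T := m.Λ₀_sub hxΛ
  have hc := hP.c_nonneg
  have hc₀ := hP.c₀_nonneg
  have hS := hP.S_nonneg
  set near := m.Λ₀.filter (fun x' => m.d x x' ≤ m.u x) with hnear
  set far := m.Λ₀.filter (fun x' => ¬ m.d x x' ≤ m.u x) with hfar
  have hsplit : ∑ x' ∈ m.Λ₀, m.C x x' * (m.B (m.blk x') - m.B (m.blk x)) =
      ∑ x' ∈ near, m.C x x' * (m.B (m.blk x') - m.B (m.blk x)) +
        ∑ x' ∈ far, m.C x x' * (m.B (m.blk x') - m.B (m.blk x)) :=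
    (Finset.sum_filter_add_sum_filter_not m.Λ₀ (fun x' => m.d x x' ≤ m.u x) _).symm
  have hsumNear : ∑ x' ∈ near, Real.exp (-(P.δ / 2 * m.d x x')) ≤ P.S :=
    le_trans (Finset.sum_le_sum_of_subset_of_nonneg
      ((Finset.filter_subset _ _).trans m.Λ₀_sub) fun _ _ _ => (Real.exp_pos _).le) (m.summable x hxT)
  have hsumFar : ∑ x' ∈ far, Real.exp (-(P.δ / 2 * m.d x x')) ≤ P.S :=
    le_trans (Finset.sum_le_sum_of_subset_of_nonneg
      ((Finset.filter_subset _ _).trans m.Λ₀_sub) fun _ _ _ => (Real.exp_pos _).le) (m.summable x hxT)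
  -- near part: ENGINE 2 with the integrated restriction (2.17)₃
  have hN : |∑ x' ∈ near, m.C x x' * (m.B (m.blk x') - m.B (m.blk x))| ≤
      P.c₀ * m.p * (P.r₁ + P.r₂ * (2 / P.δ)) * P.S := by
    refine lipschitz_sum_bound (d := fun x' => m.d x x') hc₀ hP.δ_pos m.p_nonneg hP.r₁_nonneg hP.r₂_nonneg
      (fun x' _ => m.d_nonneg x x') ?_ ?_ hsumNear
    · intro x' hx'
      exact m.kerC x hxT x' (m.Λ₀_sub (Finset.mem_filter.mp hx').1)
    · intro x' hx'
      obtain ⟨hx'Λ, hle⟩ := Finset.mem_filter.mp hx'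
      exact hR.2 x hx x' hx'Λ hle
  -- far part: ENGINE 1 with |B(y′) − B(y)| ≤ 2·tB·p and R ≤ u(x) < |x − x′|
  have hF : |∑ x' ∈ far, m.C x x' * (m.B (m.blk x') - m.B (m.blk x))| ≤
      P.c₀ * Real.exp (-(P.δ / 2 * m.R)) * (2 * m.tB * m.p) * P.S := by
    refine far_sum_bound (d := fun x' => m.d x x') hc₀ hP.δ_pos.le (by have := m.tB_nonneg; have := m.p_nonneg; positivity)
      ?_ ?_ ?_ hsumFar
    · intro x' hx'
      exact m.kerC x hxT x' (m.Λ₀_sub (Finset.mem_filter.mp hx').1)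
    · intro x' hx' _
      obtain ⟨-, hlt⟩ := Finset.mem_filter.mp hx'
      push Not at hlt
      exact (m.R_le_u x hx).trans hlt.le
    · intro x' hx'
      obtain ⟨hx'Λ, -⟩ := Finset.mem_filter.mp hx'
      calc |m.B (m.blk x') - m.B (m.blk x)| ≤ |m.B (m.blk x')| + |m.B (m.blk x)| := abs_sub _ _
        _ ≤ m.tB * m.p + m.tB * m.p := add_le_add (hR.1 x' hx'Λ) (hR.1 x hxΛ)
        _ = 2 * m.tB * m.p := by ring
  have hsep := m.sep
  rw [hsplit, mul_add]
  calc |P.c * ∑ x' ∈ near, m.C x x' * (m.B (m.blk x') - m.B (m.blk x)) +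
          P.c * ∑ x' ∈ far, m.C x x' * (m.B (m.blk x') - m.B (m.blk x))|
      ≤ P.c * |∑ x' ∈ near, m.C x x' * (m.B (m.blk x') - m.B (m.blk x))| +
          P.c * |∑ x' ∈ far, m.C x x' * (m.B (m.blk x') - m.B (m.blk x))| := by
        refine (abs_add_le _ _).trans (le_of_eq ?_)
        rw [abs_mul, abs_mul, abs_of_nonneg hc]
    _ ≤ P.c * (P.c₀ * m.p * (P.r₁ + P.r₂ * (2 / P.δ)) * P.S) +
          P.c * (P.c₀ * Real.exp (-(P.δ / 2 * m.R)) * (2 * m.tB * m.p) * P.S) :=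
        add_le_add (mul_le_mul_of_nonneg_left hN hc) (mul_le_mul_of_nonneg_left hF hc)
    _ = P.c * P.c₀ * P.S * (P.r₁ + P.r₂ * (2 / P.δ)) * m.p +
          P.c * P.c₀ * P.S * (2 * (Real.exp (-(P.δ / 2 * m.R)) * m.tB)) * m.p := by ring
    _ ≤ P.c * P.c₀ * P.S * (P.r₁ + P.r₂ * (2 / P.δ)) * m.p + P.c * P.c₀ * P.S * (2 * P.K₂) * m.p := by
        have hA : 0 ≤ P.c * P.c₀ * P.S := by positivity
        have h2 : 2 * (Real.exp (-(P.δ / 2 * m.R)) * m.tB) ≤ 2 * P.K₂ := by linarith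
        linarith [mul_le_mul_of_nonneg_right (mul_le_mul_of_nonneg_left h2 hA) m.p_nonneg]
    _ = P.c * P.c₀ * P.S * (P.r₁ + P.r₂ * (2 / P.δ) + 2 * P.K₂) * m.p := by ring

/-- TERM 4 of (2.82): by (1.18) and dist(x, Λ₀ᶜ) ≥ R, `|aL⁻²(δC^{(k)}_{Λ₀}Q*B)(x)| ≤ c·c₀e^{−δ₀R}S·(2/(μ₀L^kε))p ≤
c·c₀·S·K₂·p`. [cite: Balaban1982Higgs2, (2.82) p.574; Balaban1982Higgs1, (2.36) p.611] -/
theorem term4_bound (hP : P.Valid) (hR : m.Restr) {x : X} (hx : x ∈ m.deep) :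
    |P.c * ∑ x' ∈ m.Λ₀, (m.CΛ x x' - m.C x x') * m.B (m.blk x')| ≤ P.c * P.c₀ * P.S * P.K₂ * m.p := by
  have hxΛ : x ∈ m.Λ₀ := m.deep_sub hx
  have hxT : x ∈ m.T := m.Λ₀_sub hxΛ
  have hc := hP.c_nonneg
  have hc₀ := hP.c₀_nonneg
  have hS := hP.S_nonneg
  have htB := m.tB_nonneg
  have hp := m.p_nonneg
  have hsum : ∑ x' ∈ m.Λ₀, Real.exp (-(P.δ / 2 * m.d x x')) ≤ P.S :=
    le_trans (Finset.sum_le_sum_of_subset_of_nonneg m.Λ₀_sub fun _ _ _ => (Real.exp_pos _).le) (m.summable x hxT)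
  have hD : |∑ x' ∈ m.Λ₀, (m.CΛ x x' - m.C x x') * m.B (m.blk x')| ≤
      P.c₀ * Real.exp (-(P.δ * m.R)) * (m.tB * m.p) * P.S := by
    refine damped_sum_bound (d := fun x' => m.d x x') (u' := fun x' => m.u x') (u := m.u x) hc₀ hP.δ_pos.le
      (by positivity) (m.R_le_u x hx) (fun x' _ => m.u_nonneg x') (fun x' _ => m.d_nonneg x x') ?_ ?_ hsum
    · intro x' hx'; exact m.kerDC x hxΛ x' hx'
    · intro x' hx'; exact hR.1 x' hx'
  -- e^{−δR} ≤ e^{−½δR}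
  have hexp : Real.exp (-(P.δ * m.R)) ≤ Real.exp (-(P.δ / 2 * m.R)) := by
    rw [Real.exp_le_exp]; nlinarith [hP.δ_pos, m.R_nonneg]
  have hsep : Real.exp (-(P.δ * m.R)) * m.tB ≤ P.K₂ :=
    (mul_le_mul_of_nonneg_right hexp htB).trans m.sep
  calc |P.c * ∑ x' ∈ m.Λ₀, (m.CΛ x x' - m.C x x') * m.B (m.blk x')|
      = P.c * |∑ x' ∈ m.Λ₀, (m.CΛ x x' - m.C x x') * m.B (m.blk x')| := by rw [abs_mul, abs_of_nonneg hc]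
    _ ≤ P.c * (P.c₀ * Real.exp (-(P.δ * m.R)) * (m.tB * m.p) * P.S) := mul_le_mul_of_nonneg_left hD hc
    _ = P.c * P.c₀ * P.S * (Real.exp (-(P.δ * m.R)) * m.tB) * m.p := by ring
    _ ≤ P.c * P.c₀ * P.S * P.K₂ * m.p :=
        mul_le_mul_of_nonneg_right (mul_le_mul_of_nonneg_left hsep (by positivity)) hp

/-- **Lemma 2.5 (2.81) pointwise, PROVED for the model**: under the restrictions (2.17) on `B`, for every `x ∈ B(Λ₁^{(k)′})`
(with `y` its block), `|aL⁻²(C^{(k)}_{Λ₀^{(k)}}Q*B)(x) − B(y)| ≤ 𝒞·p(L^kε)` with `𝒞 = Consts.O1 P` independent of the instance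
— via (2.82) term by term and (2.85). [cite: Balaban1982Higgs2, Lemma 2.5 (2.81) p.574] -/
theorem lemma25_pointwise (hP : P.Valid) (hR : m.Restr) {x : X} (hx : x ∈ m.deep) :
    |m.CQsB x - m.B (m.blk x)| ≤ P.O1 * m.p := by
  have h1 := m.term1_bound hR hx
  have h2 := m.term2_bound hP hR hx
  have h3 := m.term3_bound hP hR hx
  have h4 := m.term4_bound hP hR hx
  have hid := eq282 m.T m.Λ₀ m.Λ₀_sub P.c m.C m.CΛ m.blk m.B x
  unfold CQsB
  rw [hid]
  set t1 := (P.c * ∑ x' ∈ m.T, m.C x x') * m.B (m.blk x)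
  set t2 := (P.c * ∑ x' ∈ m.T \ m.Λ₀, m.C x x') * m.B (m.blk x)
  set t3 := P.c * ∑ x' ∈ m.Λ₀, m.C x x' * (m.B (m.blk x') - m.B (m.blk x))
  set t4 := P.c * ∑ x' ∈ m.Λ₀, (m.CΛ x x' - m.C x x') * m.B (m.blk x')
  have hre : t1 - t2 + t3 + t4 - m.B (m.blk x) = (t1 - m.B (m.blk x)) + (-t2) + t3 + t4 := by ring
  rw [hre]
  calc |(t1 - m.B (m.blk x)) + (-t2) + t3 + t4|
      ≤ |t1 - m.B (m.blk x)| + |-t2| + |t3| + |t4| := by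
        have e1 := abs_add_le ((t1 - m.B (m.blk x)) + (-t2) + t3) t4
        have e2 := abs_add_le ((t1 - m.B (m.blk x)) + (-t2)) t3
        have e3 := abs_add_le (t1 - m.B (m.blk x)) (-t2)
        linarith
    _ ≤ P.K₁ * m.p + P.c * P.c₀ * P.S * P.K₂ * m.p +
          P.c * P.c₀ * P.S * (P.r₁ + P.r₂ * (2 / P.δ) + 2 * P.K₂) * m.p + P.c * P.c₀ * P.S * P.K₂ * m.p := by
        rw [abs_neg]
        exact add_le_add (add_le_add (add_le_add h1 h2) h3) h4
    _ = P.O1 * m.p := by unfold Consts.O1; ring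

/-- The second form of (2.81): `aL⁻²(C^{(k)}_{Λ₀}Q*B)(x) = (Q*B)(x) + O(p(L^kε))` — the same statement, `(Q*B)(x) = B(y)` for
`x ∈ B(y)`. [cite: Balaban1982Higgs2, Lemma 2.5 (2.81) p.574] -/
theorem lemma25_pointwise_QsB (hP : P.Valid) (hR : m.Restr) {x : X} (hx : x ∈ m.deep) :
    |m.CQsB x - m.QsB x| ≤ P.O1 * m.p :=
  m.lemma25_pointwise hP hR hx

/-! ### The suprema entering the row's carrier -/

/-- `sup over y ∈ Λ₁^{(k)′}, x ∈ B(y) of |aL⁻²(C^{(k)}_{Λ₀}Q*B)(x) − B(y)|` — the real number the row's carrier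
`B2Sect2Statements.L25Setting.dev281a` stands for, in the model (a supremum over the finite set `deep`; `0` if it is empty).
[cite: Balaban1982Higgs2, Lemma 2.5 (2.81) p.574] -/
noncomputable def dev281a : ℝ := ⨆ x : m.deep, |m.CQsB x - m.B (m.blk x)|

/-- The same supremum for the second form `|aL⁻²(C^{(k)}_{Λ₀}Q*B)(x) − (Q*B)(x)|` (`dev281b` of the row's carrier).
[cite: Balaban1982Higgs2, Lemma 2.5 (2.81) p.574] -/
noncomputable def dev281b : ℝ := ⨆ x : m.deep, |m.CQsB x - m.QsB x|

/-- The first supremum is `≤ 𝒞·p(L^kε)` under the restrictions. [cite: Balaban1982Higgs2, Lemma 2.5 (2.81) p.574] -/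
theorem dev281a_le (hP : P.Valid) (hR : m.Restr) : m.dev281a ≤ P.O1 * m.p := by
  unfold dev281a
  refine Real.iSup_le (fun x => m.lemma25_pointwise hP hR x.2) ?_
  exact mul_nonneg (Consts.O1_nonneg hP) m.p_nonneg

/-- The second supremum is `≤ 𝒞·p(L^kε)` under the restrictions. [cite: Balaban1982Higgs2, Lemma 2.5 (2.81) p.574] -/
theorem dev281b_le (hP : P.Valid) (hR : m.Restr) : m.dev281b ≤ P.O1 * m.p := by
  unfold dev281b
  refine Real.iSup_le (fun x => m.lemma25_pointwise_QsB hP hR x.2) ?_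
  exact mul_nonneg (Consts.O1_nonneg hP) m.p_nonneg

end KernelModel

/-! ## §3. Row B2.Lem2.5: the decl of record (r02) and its twin (r14), for the model family -/

/-- The family of instances of §2 read through the row's carrier `B2Sect2Statements.L25Setting` (r02, decl of record):
`p` ↤ p(L^kε), `restrB` ↤ the restrictions (2.17) on B (`KernelModel.Restr`), `dev281a`/`dev281b` ↤ the two suprema of §2.
[cite: Balaban1982Higgs2, Lemma 2.5 (2.81) p.574] -/
noncomputable def famOf (P : Consts) (X Y : Type) [DecidableEq X] (m : KernelModel P X Y) :
    B2Sect2Statements.L25Setting where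
  p := m.p
  restrB := m.Restr
  dev281a := m.dev281a
  dev281b := m.dev281b

/-- **Row B2.Lem2.5 — Lemma 2.5 (2.81) AS TYPED by the decl of record, PROVED for the model family**: for fixed constants
`P` (aL⁻², c₀, δ₀ of Prop. I.2.3, the volume and restriction constants, the (2.85) and separation bounds) the family of ALL
instances `KernelModel P X Y` (any carrier types `X`, `Y`, e.g. the points of ℤ^ν) satisfies `B2Sect2Statements.Lemma25Printed`, with the uniform `O(1)` constant `Consts.O1 P`.
[cite: Balaban1982Higgs2, Lemma 2.5 (2.81) p.574] -/
theorem lemma25Printed_model (P : Consts) (hP : P.Valid) (X Y : Type) [DecidableEq X] :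
    B2Sect2Statements.Lemma25Printed (famOf P X Y) :=
  ⟨P.O1, fun m hR => ⟨m.dev281a_le hP hR, m.dev281b_le hP hR⟩⟩

/-- The same family read through r14's twin carrier `B2StepK.L25Setting` (per-point form: `X`, `Y`, `blk`, `inL1 y` ↤ "the
block B(y) lies in B(Λ₁^{(k)′})", `CQsB`, `B`, `QsB`, `p`, `restr`). [cite: Balaban1982Higgs2, Lemma 2.5 (2.81) p.574] -/
noncomputable def famOfStepK (P : Consts) (X Y : Type) [DecidableEq X] (m : KernelModel P X Y) :
    B2StepK.L25Setting where
  X := X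
  Y := Y
  blk := m.blk
  inL1 := fun y => ∀ x : X, m.blk x = y → x ∈ m.deep
  CQsB := m.CQsB
  B := m.B
  QsB := m.QsB
  p := m.p
  restr := m.Restr

/-- **Row B2.Lem2.5 for r14's twin statement `B2StepK.Lemma25Printed`, PROVED for the model family** (same constant).
[cite: Balaban1982Higgs2, Lemma 2.5 (2.81) p.574] -/
theorem lemma25Printed_model_StepK (P : Consts) (hP : P.Valid) (X Y : Type) [DecidableEq X] :
    B2StepK.Lemma25Printed (famOfStepK P X Y) := by
  refine ⟨P.O1, fun m hR x hx => ?_⟩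
  have hxd : x ∈ m.deep := hx x rfl
  exact ⟨m.lemma25_pointwise hP hR hxd, m.lemma25_pointwise_QsB hP hR hxd⟩

/-- **(2.86)** p. 575 for the model: with the restriction (2.17)₁ at scale L^kε, `|A(x) − (Q*B)(x)| ≤ 2Ld·p(L^kε)` for the
old field `A` at a deep point, the translated field `A′ = A − aL⁻²C^{(k)}_{Λ₀}Q*B` of (2.80) satisfies `|A′(x)| ≤ (2Ld + 𝒞)·
p(L^kε)` — r14's triangle-inequality kernel `B2StepK.display286` fed with Lemma 2.5. [cite: Balaban1982Higgs2, (2.86) p.575] -/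
theorem ineq286_model {P : Consts} (hP : P.Valid) {X Y : Type} [DecidableEq X] (m : KernelModel P X Y)
    (hR : m.Restr) {x : X} (hx : x ∈ m.deep)
    {L dd : ℝ} (A : X → ℝ) (hA : |A x - m.QsB x| ≤ 2 * L * dd * m.p) :
    |A x - m.CQsB x| ≤ (2 * L * dd + P.O1) * m.p :=
  B2StepK.display286 hA (m.lemma25_pointwise_QsB hP hR hx)

/-! ## §4. Discharging the two scale fields: (2.85) ⇒ `kappa`, (2.7)–(2.8) with (2.109)-type decay ⇒ `sep` -/

/-- **(2.85) ⇒ the `kappa` field.**  With the printed value κ = aL⁻²C^{(k)}1 = (1 + a⁻¹L²a_kμ₀²ℓ²/(a_k + μ₀²ℓ²))⁻¹ (ℓ = L^kε;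
r14's `display285`), its bound |κ − 1| ≤ (L²/a)μ₀²ℓ² (`display285_bound`) and the threshold tB = 2/(μ₀ℓ) of (2.17)₂:
`|κ − 1|·tB ≤ 2L²μ₀ℓ/a ≤ 2L²/a` as soon as μ₀ℓ ≤ 1 — so `K₁ = 2L²/a` serves every step. [cite: Balaban1982Higgs2, (2.85) p.575] -/
theorem kappa_of_display285 {a L ak μ₀ ℓ : ℝ} (ha : 0 < a) (hak : 0 < ak) (hμ₀ : 0 < μ₀) (hℓ : 0 < ℓ)
    (hμℓ : μ₀ * ℓ ≤ 1) :
    |(1 + a⁻¹ * L ^ 2 * (ak * (μ₀ ^ 2 * ℓ ^ 2) / (ak + μ₀ ^ 2 * ℓ ^ 2)))⁻¹ - 1| * (2 / (μ₀ * ℓ)) ≤ 2 * L ^ 2 / a := by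
  have hb := B2StepK.display285_bound (L := L) ha hak (by positivity : (0 : ℝ) ≤ μ₀ ^ 2 * ℓ ^ 2)
  have hμℓpos : 0 < μ₀ * ℓ := mul_pos hμ₀ hℓ
  calc |(1 + a⁻¹ * L ^ 2 * (ak * (μ₀ ^ 2 * ℓ ^ 2) / (ak + μ₀ ^ 2 * ℓ ^ 2)))⁻¹ - 1| * (2 / (μ₀ * ℓ))
      ≤ (L ^ 2 / a * (μ₀ ^ 2 * ℓ ^ 2)) * (2 / (μ₀ * ℓ)) := mul_le_mul_of_nonneg_right hb (by positivity)
    _ = 2 * L ^ 2 / a * (μ₀ * ℓ) := by field_simp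
    _ ≤ 2 * L ^ 2 / a * 1 := mul_le_mul_of_nonneg_left hμℓ (by positivity)
    _ = 2 * L ^ 2 / a := mul_one _

/-- **(2.7)–(2.8) ⇒ the `sep` field.**  If the deep points are farther than r(ℓ) = R(1 + log ℓ⁻¹)^r from Λ₀ᶜ (the separation
`Rsep ≥ r(ℓ)` of (2.8) at scale ℓ = L^kε ∈ (0,1]) and exp(−½δ₀r(ℓ)) ≤ C₁ℓ (r14's `B2StepK.RDecayBeatsPowers` at κ = 1, which
holds for the printed ranges r > 1, R > 0: `rDecayBeatsPowers`), then `e^{−½δ₀Rsep}·(2/(μ₀ℓ)) ≤ 2C₁/μ₀` — so `K₂ = 2C₁/μ₀`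
serves every step. [cite: Balaban1982Higgs2, (2.7)–(2.8) p.558; (2.109) p.580] -/
theorem sep_of_rDecayBeatsPowers {δ₀ Rr r ℓ μ₀ Rsep C₁ : ℝ} (hδ : 0 ≤ δ₀) (hμ₀ : 0 < μ₀) (hℓ : 0 < ℓ)
    (hsep : B2.rFn Rr r ℓ ≤ Rsep) (hC₁ : Real.exp (-(δ₀ / 2 * B2.rFn Rr r ℓ)) ≤ C₁ * ℓ) :
    Real.exp (-(δ₀ / 2 * Rsep)) * (2 / (μ₀ * ℓ)) ≤ 2 * C₁ / μ₀ := by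
  have h1 : Real.exp (-(δ₀ / 2 * Rsep)) ≤ Real.exp (-(δ₀ / 2 * B2.rFn Rr r ℓ)) := by
    rw [Real.exp_le_exp]
    have := mul_le_mul_of_nonneg_left hsep (by positivity : (0 : ℝ) ≤ δ₀ / 2)
    linarith
  have hμℓ : 0 < μ₀ * ℓ := mul_pos hμ₀ hℓ
  calc Real.exp (-(δ₀ / 2 * Rsep)) * (2 / (μ₀ * ℓ)) ≤ (C₁ * ℓ) * (2 / (μ₀ * ℓ)) :=
        mul_le_mul_of_nonneg_right (h1.trans hC₁) (by positivity)
    _ = 2 * C₁ / μ₀ := by field_simp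

/-- The κ = 1 instance of r14's `RDecayBeatsPowers` in the form used by `sep_of_rDecayBeatsPowers`: for δ₀ > 0 and the
printed ranges r > 1, R > 0 there is C₁ with exp(−½δ₀r(ℓ)) ≤ C₁ℓ for all ℓ ∈ (0,1]. [cite: Balaban1982Higgs2, (2.109) p.580; (2.7) p.558] -/
theorem exists_C₁_rDecay {δ₀ Rr r : ℝ} (hδ : 0 < δ₀) (hR : 0 < Rr) (hr : 1 < r) :
    ∃ C₁ : ℝ, ∀ ℓ : ℝ, 0 < ℓ → ℓ ≤ 1 → Real.exp (-(δ₀ / 2 * B2.rFn Rr r ℓ)) ≤ C₁ * ℓ := by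
  obtain ⟨C, hC⟩ := B2StepK.rDecayBeatsPowers (half_pos hδ) hR hr 1
  exact ⟨C, fun ℓ hℓ hℓ1 => by simpa [Real.rpow_one] using hC ℓ hℓ hℓ1⟩


/-! ## §5. The volume constant on ℤ^ν: `Σ_{x′} e^{−½δ₀|x−x′|₁} ≤ (1 + 4/δ₀)^ν` (pattern of `B10Eq45LatticeSum`) -/

section LatticeVolume

variable {ν : ℕ}

/-- The ℓ¹ lattice distance on ℤ^ν (lattice units), the model reading of `|x − x′|` in (I.2.36)/(1.16).
[cite: Balaban1982Higgs1, (2.36) p.611] -/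
def l1dist (x y : Fin ν → ℤ) : ℝ := ∑ i, |((x i - y i : ℤ) : ℝ)|

/-- `|x − x′|₁ ≥ 0`. [cite: Balaban1982Higgs1, (2.36) p.611] -/
theorem l1dist_nonneg (x y : Fin ν → ℤ) : 0 ≤ l1dist x y :=
  Finset.sum_nonneg fun _ _ => abs_nonneg _

/-- `|x − x′|₁ = |x′ − x|₁`. [cite: Balaban1982Higgs1, (2.36) p.611] -/
theorem l1dist_comm (x y : Fin ν → ℤ) : l1dist x y = l1dist y x := by
  unfold l1dist
  refine Finset.sum_congr rfl fun i _ => ?_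
  rw [← abs_neg]; congr 1; push_cast; ring

/-- `Σ_{m ∈ ℤ} e^{−b|m|} = (1 + e^{−b})/(1 − e^{−b})` for `b > 0` (two geometric series; as in
`B10Eq45LatticeSum`/`B6Lemma21Arith`). [folklore] -/
private theorem tsum_int_exp_neg_mul_abs {b : ℝ} (hb : 0 < b) :
    Summable (fun m : ℤ => Real.exp (-(b * |(m : ℝ)|))) ∧
      ∑' m : ℤ, Real.exp (-(b * |(m : ℝ)|)) = (1 + Real.exp (-b)) / (1 - Real.exp (-b)) := by
  have hr : Real.exp (-b) < 1 := by rw [Real.exp_lt_one_iff]; linarith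
  have hr0 : 0 ≤ Real.exp (-b) := (Real.exp_pos _).le
  have hnat_eq : (fun n : ℕ => Real.exp (-(b * |((n : ℤ) : ℝ)|))) = fun n : ℕ => Real.exp (-b) ^ n := by
    funext n
    rw [← Real.exp_nat_mul]; congr 1
    rw [Int.cast_natCast, abs_of_nonneg (Nat.cast_nonneg n)]; ring
  have hneg_eq : (fun n : ℕ => Real.exp (-(b * |((-((n : ℤ) + 1) : ℤ) : ℝ)|)))
      = fun n : ℕ => Real.exp (-b) * Real.exp (-b) ^ n := by
    funext n
    rw [← pow_succ', ← Real.exp_nat_mul]; congr 1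
    have hc : ((-((n : ℤ) + 1) : ℤ) : ℝ) = -((n : ℝ) + 1) := by push_cast; ring
    rw [hc, abs_neg, abs_of_nonneg (by positivity)]; push_cast; ring
  have hnat : Summable fun n : ℕ => Real.exp (-(b * |((n : ℤ) : ℝ)|)) := by
    rw [hnat_eq]; exact summable_geometric_of_lt_one hr0 hr
  have hneg : Summable fun n : ℕ => Real.exp (-(b * |((-((n : ℤ) + 1) : ℤ) : ℝ)|)) := by
    rw [hneg_eq]; exact (summable_geometric_of_lt_one hr0 hr).mul_left _
  have h1 : ∑' n : ℕ, Real.exp (-(b * |((n : ℤ) : ℝ)|)) = (1 - Real.exp (-b))⁻¹ := by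
    rw [hnat_eq]; exact tsum_geometric_of_lt_one hr0 hr
  have h2 : ∑' n : ℕ, Real.exp (-(b * |((-((n : ℤ) + 1) : ℤ) : ℝ)|))
      = Real.exp (-b) * (1 - Real.exp (-b))⁻¹ := by
    rw [hneg_eq, tsum_mul_left, tsum_geometric_of_lt_one hr0 hr]
  refine ⟨Summable.of_nat_of_neg_add_one (f := fun z : ℤ => Real.exp (-(b * |(z : ℝ)|))) hnat hneg, ?_⟩
  rw [tsum_of_nat_of_neg_add_one (f := fun z : ℤ => Real.exp (-(b * |(z : ℝ)|))) hnat hneg, h1, h2]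
  have hne : 1 - Real.exp (-b) ≠ 0 := by linarith
  field_simp

/-- One-dimensional factor: `Σ_{n ∈ [c−R, c+R]} e^{−b|n − c|} ≤ Σ_{m∈ℤ} e^{−b|m|} ≤ 1 + 2/b`. [folklore] -/
private theorem sum_Icc_exp_le {b : ℝ} (hb : 0 < b) (c : ℤ) (R : ℕ) :
    ∑ n ∈ Finset.Icc (c - R) (c + R), Real.exp (-(b * |((n - c : ℤ) : ℝ)|)) ≤ 1 + 2 / b := by
  obtain ⟨hS, hval0⟩ := tsum_int_exp_neg_mul_abs hb
  set f : ℤ → ℝ := fun m => Real.exp (-(b * |(m : ℝ)|)) with hf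
  have hshift : ∑ n ∈ Finset.Icc (c - R) (c + R), f (n - c) ≤ ∑' m : ℤ, f m := by
    have hS' : Summable (fun n : ℤ => f (n - c)) := (Equiv.subRight c).summable_iff.mpr hS
    calc ∑ n ∈ Finset.Icc (c - R) (c + R), f (n - c) ≤ ∑' n : ℤ, f (n - c) :=
          hS'.sum_le_tsum _ (fun n _ => (Real.exp_pos _).le)
      _ = ∑' m : ℤ, f m := (Equiv.subRight c).tsum_eq f
  have htail : Real.exp (-b) / (1 - Real.exp (-b)) ≤ 1 / b := by
    have hr1 : Real.exp (-b) < 1 := Real.exp_lt_one_iff.mpr (by linarith)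
    have h : Real.exp (-b) * (b + 1) ≤ 1 := by
      calc Real.exp (-b) * (b + 1) ≤ Real.exp (-b) * Real.exp b :=
            mul_le_mul_of_nonneg_left (by linarith [Real.add_one_le_exp b]) (Real.exp_pos _).le
        _ = 1 := by rw [← Real.exp_add]; simp
    rw [div_le_div_iff₀ (by linarith) hb]
    nlinarith [h, Real.exp_pos (-b)]
  have hval : (1 + Real.exp (-b)) / (1 - Real.exp (-b)) = 1 + 2 * (Real.exp (-b) / (1 - Real.exp (-b))) := by
    have hr1 : Real.exp (-b) < 1 := Real.exp_lt_one_iff.mpr (by linarith)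
    have hne : 1 - Real.exp (-b) ≠ 0 := by linarith
    field_simp
    ring
  calc ∑ n ∈ Finset.Icc (c - R) (c + R), Real.exp (-(b * |((n - c : ℤ) : ℝ)|))
      = ∑ n ∈ Finset.Icc (c - R) (c + R), f (n - c) := rfl
    _ ≤ ∑' m : ℤ, f m := hshift
    _ = (1 + Real.exp (-b)) / (1 - Real.exp (-b)) := hval0
    _ = 1 + 2 * (Real.exp (-b) / (1 - Real.exp (-b))) := hval
    _ ≤ 1 + 2 * (1 / b) := by linarith [htail]
    _ = 1 + 2 / b := by ring

/-- The pure decay sum over ANY finite set of sites of ℤ^ν: `Σ_{x′ ∈ S} e^{−b|x − x′|₁} ≤ (1 + 2/b)^ν` (enclose `S` in a box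
around `x`; the box sum factorizes).  General-dimension form of `B10Eq45LatticeSum.sum_exp_neg_l1dist_le` (there ν = 3);
the volume factor of the x′-summations in (2.82). [cite: Balaban1982Higgs2, (2.82) p.574] -/
theorem sum_exp_neg_l1dist_le {b : ℝ} (hb : 0 < b) (x : Fin ν → ℤ) (S : Finset (Fin ν → ℤ)) :
    ∑ x' ∈ S, Real.exp (-(b * l1dist x x')) ≤ (1 + 2 / b) ^ ν := by
  classical
  set R : ℕ := S.sup fun x' => Finset.univ.sup fun i => (x' i - x i).natAbs with hR
  set box : Finset (Fin ν → ℤ) := Fintype.piFinset fun i => Finset.Icc (x i - R) (x i + R) with hbox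
  have hsub : S ⊆ box := by
    intro x' hx'
    rw [hbox, Fintype.mem_piFinset]
    intro i
    have hi : (x' i - x i).natAbs ≤ R := by
      rw [hR]
      exact le_trans (Finset.le_sup (f := fun i => (x' i - x i).natAbs) (Finset.mem_univ i))
        (Finset.le_sup (f := fun x' => Finset.univ.sup fun i => (x' i - x i).natAbs) hx')
    rw [Finset.mem_Icc]
    have hi' : (((x' i - x i).natAbs : ℕ) : ℤ) ≤ (R : ℤ) := by exact_mod_cast hi
    rw [Int.natCast_natAbs] at hi'
    obtain ⟨h1, h2⟩ := abs_le.mp hi'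
    constructor <;> omega
  have hterm : ∀ x' : Fin ν → ℤ, Real.exp (-(b * l1dist x x')) =
      ∏ i, Real.exp (-(b * |((x' i - x i : ℤ) : ℝ)|)) := by
    intro x'
    rw [l1dist_comm, ← Real.exp_sum, l1dist, Finset.mul_sum, ← Finset.sum_neg_distrib]
  calc ∑ x' ∈ S, Real.exp (-(b * l1dist x x'))
      ≤ ∑ x' ∈ box, Real.exp (-(b * l1dist x x')) :=
        Finset.sum_le_sum_of_subset_of_nonneg hsub fun _ _ _ => (Real.exp_pos _).le
    _ = ∑ x' ∈ box, ∏ i, Real.exp (-(b * |((x' i - x i : ℤ) : ℝ)|)) := Finset.sum_congr rfl fun x' _ => hterm x'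
    _ = ∏ i : Fin ν, ∑ n ∈ Finset.Icc (x i - R) (x i + R), Real.exp (-(b * |((n - x i : ℤ) : ℝ)|)) := by
        rw [hbox, Finset.prod_univ_sum]
    _ ≤ ∏ _i : Fin ν, (1 + 2 / b) := by
        apply Finset.prod_le_prod
        · intro i _; exact Finset.sum_nonneg fun n _ => (Real.exp_pos _).le
        · intro i _; exact sum_Icc_exp_le hb (x i) R
    _ = (1 + 2 / b) ^ ν := by simp

/-- The `summable` field of an instance whose points sit in ℤ^ν with `|x − x′| = |x − x′|₁`: for every finite `T` and
`x`, `Σ_{x′∈T} e^{−½δ₀|x − x′|₁} ≤ (1 + 4/δ₀)^ν` — so `S = (1 + 4/δ₀)^ν` serves every volume (the x′-summations of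
(2.82)). [cite: Balaban1982Higgs2, (2.82) p.574] -/
theorem summable_field_Zd {δ : ℝ} (hδ : 0 < δ) (T : Finset (Fin ν → ℤ)) (x : Fin ν → ℤ) :
    ∑ x' ∈ T, Real.exp (-(δ / 2 * l1dist x x')) ≤ (1 + 4 / δ) ^ ν := by
  have h := sum_exp_neg_l1dist_le (half_pos hδ) x T
  have h4 : (1 + 2 / (δ / 2)) = 1 + 4 / δ := by rw [div_div_eq_mul_div]; ring
  rwa [h4] at h

end LatticeVolume

end Literature.MathematicalPhysics.QuantumFieldTheory.Balaban1983to89.B2Lemma25Proof
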